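import Mathlib
import Literature.Computability.Complexity.BooleanFourier
import Literature.Combinatorics.Optimization.PseudoDensityFourier
import HarnessLib

/-!
# Barrier: directional globalness of a whitened psd field does not bound its layer energy
# (sign-feature projection fields; the operator-norm "matrix Keller–Lifshitz input" of the r-uniform programme is false for r ≥ 2)

Third barrier of the cell pnp-psdrank (route `ChebyshevTracialDesign`, crux `TracialDecayExp20` = stmt-PneNP-19878),
after `RectanglePositivityNoLift` / `RectanglePositivityNoLiftLowDegree`. The prover's one-sided normal form and
whitened mode bound (kernel bricks 86/87, cell memo MEMO-19 §2) reduce the crux's open content — r-UNIFORMITY in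
the directionally sparse regime — to a bound on the OPERATOR-NORM LAYER ENERGIES
`α_κ = ‖Σ_U (A_U^{(2κ)})²‖_op` of the WHITENED cut-side field `A_U = X̄^{−1/2} X_U X̄^{−1/2}` (`Σ_U A_U = N·I`,
`A_U ⪰ 0`), and propose as the missing input a matrix / vector-valued Keller–Lifshitz inequality (`hKLvec`):
«if `A` is DIRECTIONALLY GLOBAL (no pin set `π` of bounded size raises the mean in any direction,
`Σ_{U ⊇ π} A_U ⪯ τ^{|π|}·#{U ⊇ π}·I`) then `α_κ ≤ λ_κ(τ)·N` with `λ_κ ≪ 1`» — the scalar case `r = 1` being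
the Keller–Lifshitz / Keevash–Lifshitz level-`d` inequality for global functions
[cite: KeevashLifshitz2023, Thm. 1.8] (tree: `Literature.Combinatorics.Additive.GlobalLevelInequality`).
THIS FILE PROVES that no such inequality exists with `λ` independent of the dimension `r`, on the cube
`{0,1}^m` (all identities exact):

* `sfField S x = w(x) w(x)ᵀ`, `w(x) = (χ_{S_1}(x), …, χ_{S_r}(x))` for a BLOCK FAMILY `S` (pairwise disjoint
  `k`-sets of coordinates; the standard one `blocks r k` on `m = r·k` coordinates): the
  whitened form of the rank-one projection field `X(x) = w wᵀ/r` (mean `I/r`, density `1/r` in every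
  direction) — the SIGN-FEATURE field of the Frankl–Wilson / Buhrman–Cleve–Wigderson configuration
  [cite: BuhrmanCleveWigderson1998, §3] [cite: FranklWilson1981, §3].
* `sfField_posSemidef`; `sum_sfField`: `Σ_x A(x) = 2^m·I` (whitened normalisation);
  `sum_sfField_piecewise`: **perfect directional globalness** — for EVERY `|J| < 2k` and every assignment
  `σ`, `Σ_x A(x|_{J←σ}) = 2^m·I` (restriction in O'Donnell's form `f_{J|σ}` [cite: ODonnell2014, §3.3 and Prop. 3.21]):
  no pin set of size `< 2k` changes the mean in any direction at all (`τ = 1`).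
* `layer A d x = Σ_{|T|=d} Â(T) χ_T(x)` (entrywise Fourier layers); `layer_sfField`: the field lives on
  levels `0` and `2k` and `A^{(2k)} = A − I`; `sum_layer_sq`: **`Σ_x (A^{(2k)}(x))² = (r−1)·2^m·I`** —
  layer energy `(r − 1)·N` in EVERY direction (`A² = rA`).
* `GlobalnessBoundsLayerEnergy c` — the TECHNIQUE CLASS (an `r`-independent constant `c(k)` with
  `Σ_x (A^{(2k)})² ⪯ c(k)·2^m·I` for all psd, whitened, perfectly-global-below-`2k` fields) — and the BARRIER:
  `constant_ge` (`c(k) ≥ r − 1` for every `r ≥ 1` and every `k ≥ 1`), `not_globalnessBoundsLayerEnergy`.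

technique_class: r-INDEPENDENT OPERATOR-NORM LAYER-ENERGY BOUNDS FROM DIRECTIONAL GLOBALNESS — any inequality
  «psd field `A` on the cube, `Σ_x A(x) = N·I`, directionally global with pins of size `< 2k` (even with
  `τ = 1`) ⇒ `Σ_x (A^{(2k)}(x))² ⪯ c·N·I`» with `c` depending on `k` (and on a globalness parameter) but
  NOT on `r`; formalised as `GlobalnessBoundsLayerEnergy c`. [cite: KeevashLifshitz2023, Thm. 1.8 (the scalar statement being generalised)]
  [cite: BenAroyaRegevDeWolf2008, Thm. 1 (the matrix hypercontractivity that does hold, in normalised Schatten norms)]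
blocks: feeding the whitened mode bound `(★)` of the cell (MEMO-19 §2(d): `|C_κ| ≤ √(λ_{2κ}·α_κ·β)·tr(X̄Ȳ)`,
  brick 87 `whitened_HSmode_sq_le`) with a hypothesis `hKLvec : α_κ ≤ λ_κ·N`, `λ_κ ≪ 1/(R_κ² n^κ A_κ^{−1})`,
  derived from directional globalness of the cut side alone: by `constant_ge` such a `λ_κ` is `≥ r − 1` at
  `κ = k` already for perfectly global fields, so the `κ = k` term of `(★)` is `≳ √((2k−1)!!·r/(n^k·λ_min(Ȳ)))`
  and certifies nothing once `r ≳ n^k·λ_min(Ȳ)/(2k−1)!!`. It blocks ONLY the decoupled route (layer energy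
  of `X` alone times energy of `Y` alone); it is the Frankl–Wilson sign-feature phenomenon of the first two
  barriers seen inside the prover's normal form.
because: for `w(x) = (χ_{S_i}(x))_i` with pairwise disjoint `k`-blocks, `w wᵀ` has diagonal `1` and off-diagonal
  entries `χ_{S_i}χ_{S_j} = χ_{S_i ∪ S_j}`, characters of degree exactly `2k`
  [cite: ODonnell2014, Fact 1.6 and Thm. 1.5]: restricting `< 2k` coordinates leaves every off-diagonal
  character unbiased (mean exactly `I`), while the layer-`2k` part is the whole off-diagonal part `A − I`,
  whose square sums to `(r−2)·Σ A + Σ I = (r−1)·2^m·I` because `A² = |w|²·A = r·A`.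
evasions_known: (i) TRACE NORMALISATION: the level law that IS dimension-free is
  `Σ_S δ^{|S|}(‖X̂(S)‖_tr/r)² ≤ μ^{2/(1+δ)}` for the UNWHITENED contraction field
  (`Literature.Computability.Complexity.MatrixHypercontractivity.contraction_traceNorm_level_le`, from
  [cite: BenAroyaRegevDeWolf2008, Thm. 1]); on the sign-feature field it gives `Σ_{|S|=2k}(‖X̂(S)‖_tr/r)² =
  2(r−1)/r·μ²`, `μ = 1/r` — small. Its price: the matching side must then be measured in operator norm, i.e.
  by an `r = 1` test per character (cell memo LIT-30 §5). (ii) COUPLING: bound the mode `C_κ = Σ_M tr(H^κ_M Y_M)`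
  itself, keeping cut and matching sides coupled through the twist, instead of `α_κ·β` (Cauchy–Schwarz is
  lossy exactly on sign features, whose `C_κ` against a concrete `Y` carries cancelling signs). (iii) Exactly
  `2k`-sized symmetric differences need disjoint blocks (`r ≤ m/k`); for exponentially many directions use any
  binary code with pairwise distances `≥ 2k` — globalness below `2k` is unchanged and the off-diagonal energy,
  now spread over levels `≥ 2k`, still totals `(r−1)·N` (not formalised here; "none published").
scope_caveats: proved on the CUBE `{0,1}^m` with O'Donnell restrictions; the cell's cut side is a SLICE
  `C([n],t)`, where characters restricted to sub-slices have `o(1)` biases (globalness holds with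
  `τ = 1 + o(1)`, not exactly `1`) — not formalised. The barrier concerns OPERATOR-norm (psd-order) energy
  bounds with `r`-independent constants; it says nothing against bounds in which `c` may grow like `r`
  (true and useless), against trace-normalised laws (evasion (i)), or against coupled mode bounds (evasion
  (ii)); and nothing about the crux itself. Pins here fix coordinates of the cube (O'Donnell `J.piecewise σ`),
  the faithful image of the cell's pin sets.
status: established (elementary character computation, this file; numerically cross-checked for
  `(r,k) ∈ {(4,2),(3,3),(6,1),(5,2)}`, cell job j296248).
-/

noncomputable section

open Finset Matrix

namespace Literature.Barriers.PneNP.GlobalFieldLayerEnergy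

open Literature.Computability.Complexity.LowDegree (cubeFourierCoeff sum_walsh_mul_walsh_index walsh_piecewise)
open Literature.Probability.RandomGraphs.LowDegree (walsh sgn walsh_empty sgn_mul_self)
open Literature.Combinatorics.Optimization (walsh_mul_self)

variable {m r : ℕ}

/-! ### §1 Walsh characters: elementary facts (`χ_T² = 1` is the tree's `walsh_mul_self`) -/

/-- `χ_{S ∪ T} = χ_S χ_T` for disjoint `S, T`. [cite: ODonnell2014, Fact 1.6] -/
theorem walsh_union {S T : Finset (Fin m)} (h : Disjoint S T) (x : Fin m → Bool) :
    walsh (S ∪ T) x = walsh S x * walsh T x := by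
  unfold walsh; exact Finset.prod_union h

/-- `Σ_x χ_T(x) = 0` for `T ≠ ∅`. [cite: ODonnell2014, Thm. 1.5 (orthogonality, against χ_∅)] -/
theorem sum_walsh_eq_zero {T : Finset (Fin m)} (hT : T ≠ ∅) : ∑ x : Fin m → Bool, walsh T x = 0 := by
  have h := sum_walsh_mul_walsh_index T ∅
  simp only [walsh_empty, mul_one, if_neg hT] at h
  exact h

/-- `χ̂_V(T) = [V = T]`. [cite: ODonnell2014, Thm. 1.5] -/
theorem cubeFourierCoeff_walsh (V T : Finset (Fin m)) :
    cubeFourierCoeff (fun y => walsh V y) T = if V = T then 1 else 0 := by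
  unfold cubeFourierCoeff
  rw [sum_walsh_mul_walsh_index]
  split_ifs
  · exact div_self (by positivity)
  · exact zero_div _

/-! ### §2 Layers of a matrix-valued function on the cube -/

/-- The level-`d` part `A^{(d)}(x) = Σ_{|T| = d} Â(T) χ_T(x)` of a matrix-valued function on `{0,1}^m`
(entrywise Fourier expansion). [cite: BenAroyaRegevDeWolf2008, §1.1 (Fourier transform of matrix-valued functions, entrywise)]
[cite: ODonnell2014, §1.4, Def. 1.19 (degree-k part / weight at degree k)] -/
def layer (A : (Fin m → Bool) → Matrix (Fin r) (Fin r) ℝ) (d : ℕ) (x : Fin m → Bool) :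
    Matrix (Fin r) (Fin r) ℝ :=
  Matrix.of fun i j =>
    ∑ T ∈ (Finset.univ : Finset (Finset (Fin m))).filter (fun T => T.card = d),
      cubeFourierCoeff (fun y => A y i j) T * walsh T x

/-! ### §3 The sign-feature projection field of a block family -/

/-- The sign vector `w(x) = (χ_{S_1}(x), …, χ_{S_r}(x))` of a family of blocks `S`. [cite: BuhrmanCleveWigderson1998, §3 (±1 feature vectors)] -/
def signVec (S : Fin r → Finset (Fin m)) (x : Fin m → Bool) : Fin r → ℝ := fun i => walsh (S i) x

/-- The SIGN-FEATURE FIELD `A(x) = w(x) w(x)ᵀ` (`= r ·` the rank-one projection onto `w(x)/√r`): the whitened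
form of the projection field `X(x) = w wᵀ / r`, whose mean is `I/r`. [cite: BuhrmanCleveWigderson1998, §3]
[cite: FranklWilson1981, §3 (±1 vectors and their Gram structure)] -/
def sfField (S : Fin r → Finset (Fin m)) (x : Fin m → Bool) : Matrix (Fin r) (Fin r) ℝ :=
  vecMulVec (signVec S x) (signVec S x)

/-- Entries of the sign-feature field. [cite: BuhrmanCleveWigderson1998, §3] -/
theorem sfField_apply (S : Fin r → Finset (Fin m)) (x : Fin m → Bool) (i j : Fin r) :
    sfField S x i j = walsh (S i) x * walsh (S j) x := rfl

/-- `A(x) ⪰ 0`. [cite: BuhrmanCleveWigderson1998, §3] -/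
theorem sfField_posSemidef (S : Fin r → Finset (Fin m)) (x : Fin m → Bool) : (sfField S x).PosSemidef := by
  have h := Matrix.posSemidef_vecMulVec_self_star (R := ℝ) (signVec S x)
  simp only [star_trivial] at h
  exact h

/-- `|w(x)|² = r`. [cite: BuhrmanCleveWigderson1998, §3] -/
theorem signVec_dot (S : Fin r → Finset (Fin m)) (x : Fin m → Bool) :
    signVec S x ⬝ᵥ signVec S x = r := by
  unfold signVec dotProduct
  simp_rw [walsh_mul_self]
  simp

/-- `A(x)² = r · A(x)`. [cite: BuhrmanCleveWigderson1998, §3] -/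
theorem sfField_mul_self (S : Fin r → Finset (Fin m)) (x : Fin m → Bool) :
    sfField S x * sfField S x = (r : ℝ) • sfField S x := by
  unfold sfField
  rw [vecMulVec_mul_vecMulVec, signVec_dot, vecMulVec_smul]

/-! A BLOCK FAMILY is a family `S : Fin r → Finset (Fin m)` of pairwise disjoint `k`-subsets of the
coordinates; the two properties are carried as the hypotheses `hc : ∀ i, (S i).card = k` and
`hd : ∀ i j, i ≠ j → Disjoint (S i) (S j)` below. -/

variable {S : Fin r → Finset (Fin m)} {k : ℕ}

/-- Distinct blocks are distinct sets (for `k ≥ 1`). [folklore] -/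
private theorem ne_of_ne (hc : ∀ i, (S i).card = k) (hd : ∀ i j, i ≠ j → Disjoint (S i) (S j)) (hk : 1 ≤ k)
    {i j : Fin r} (hij : i ≠ j) : S i ≠ S j := by
  intro h
  have hd' := hd i j hij
  rw [h, disjoint_self, Finset.bot_eq_empty] at hd'
  have := hc j
  rw [hd', Finset.card_empty] at this
  omega

/-- `|S_i ∪ S_j| = 2k` for `i ≠ j`. [folklore] -/
private theorem card_union (hc : ∀ i, (S i).card = k) (hd : ∀ i j, i ≠ j → Disjoint (S i) (S j)) {i j : Fin r}
    (hij : i ≠ j) : (S i ∪ S j).card = 2 * k := by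
  rw [Finset.card_union_of_disjoint (hd i j hij), hc, hc]; ring

/-- **WHITENED NORMALISATION**: `Σ_x A(x) = 2^m · I` (the mean of the projection field `A/r` is `I/r`).
[cite: BuhrmanCleveWigderson1998, §3] [cite: ODonnell2014, Thm. 1.5] -/
theorem sum_sfField (hc : ∀ i, (S i).card = k) (hd : ∀ i j, i ≠ j → Disjoint (S i) (S j)) (hk : 1 ≤ k) :
    ∑ x : Fin m → Bool, sfField S x = ((2 : ℝ) ^ m) • (1 : Matrix (Fin r) (Fin r) ℝ) := by
  ext i j
  rw [Matrix.sum_apply]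
  simp_rw [sfField_apply]
  rw [sum_walsh_mul_walsh_index, Matrix.smul_apply, Matrix.one_apply, smul_eq_mul, mul_ite, mul_one, mul_zero]
  by_cases hij : i = j
  · rw [if_pos (congrArg S hij), if_pos hij]
  · rw [if_neg (ne_of_ne hc hd hk hij), if_neg hij]

/-- **PERFECT DIRECTIONAL GLOBALNESS**: restricting any `|J| < 2k` coordinates to any values leaves the mean
EXACTLY `I` — `Σ_x A(x|_{J←σ}) = 2^m · I` — so no pin set of size `< 2k` raises the density of the field in
any direction (`τ = 1` in the Keller–Lifshitz sense). [cite: ODonnell2014, §3.3 and Prop. 3.21 (restrictions f_{J|z} and their Fourier coefficients)] -/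
theorem sum_sfField_piecewise (hc : ∀ i, (S i).card = k) (hd : ∀ i j, i ≠ j → Disjoint (S i) (S j)) (J : Finset (Fin m)) (σ : Fin m → Bool)
    (hJ : J.card < 2 * k) :
    ∑ x : Fin m → Bool, sfField S (J.piecewise σ x) = ((2 : ℝ) ^ m) • (1 : Matrix (Fin r) (Fin r) ℝ) := by
  ext i j
  rw [Matrix.sum_apply]
  simp_rw [sfField_apply]
  rw [Matrix.smul_apply, Matrix.one_apply, smul_eq_mul, mul_ite, mul_one, mul_zero]
  by_cases hij : i = j
  · subst hij
    simp_rw [walsh_mul_self]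
    rw [if_pos trivial, Finset.sum_const, Finset.card_univ, nsmul_eq_mul, mul_one]
    simp
  · rw [if_neg hij]
    simp_rw [← walsh_union (hd i j hij), walsh_piecewise, ← Finset.mul_sum]
    have hne : (S i ∪ S j).filter (· ∉ J) ≠ ∅ := by
      intro h
      have hsub : S i ∪ S j ⊆ J := by
        intro l hl
        by_contra hlJ
        have : l ∈ (S i ∪ S j).filter (· ∉ J) := Finset.mem_filter.2 ⟨hl, hlJ⟩
        rw [h] at this
        exact Finset.notMem_empty l this
      have := Finset.card_le_card hsub
      rw [card_union hc hd hij] at this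
      omega
    rw [sum_walsh_eq_zero hne, mul_zero]

/-- **THE FIELD LIVES ON LEVELS `0` AND `2k`**, and its layer-`2k` part is its off-diagonal part:
`A^{(2k)}(x) = A(x) − I`. [cite: ODonnell2014, Thm. 1.5 and Fact 1.6 (χ_{S_i}χ_{S_j} = χ_{S_i ∪ S_j}, a character of degree 2k)] -/
theorem layer_sfField (hc : ∀ i, (S i).card = k) (hd : ∀ i j, i ≠ j → Disjoint (S i) (S j)) (hk : 1 ≤ k) (x : Fin m → Bool) :
    layer (sfField S) (2 * k) x = sfField S x - 1 := by
  ext i j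
  rw [layer, Matrix.of_apply, Matrix.sub_apply, sfField_apply, Matrix.one_apply]
  by_cases hij : i = j
  · subst hij
    simp_rw [sfField_apply, walsh_mul_self]
    rw [if_pos trivial, sub_self]
    refine Finset.sum_eq_zero fun T hT => ?_
    have hTc := (Finset.mem_filter.1 hT).2
    have h1 : cubeFourierCoeff (fun _y : Fin m → Bool => (1 : ℝ)) T = 0 := by
      have h := cubeFourierCoeff_walsh (∅ : Finset (Fin m)) T
      simp only [walsh_empty] at h
      rw [h, if_neg]
      rintro rfl
      rw [Finset.card_empty] at hTc
      omega
    rw [h1, zero_mul]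
  · rw [if_neg hij, sub_zero]
    simp_rw [sfField_apply, ← walsh_union (hd i j hij), cubeFourierCoeff_walsh, ite_mul, one_mul,
      zero_mul]
    rw [Finset.sum_ite_eq, if_pos]
    exact Finset.mem_filter.2 ⟨Finset.mem_univ _, card_union hc hd hij⟩

/-- **THE LAYER ENERGY IS MAXIMAL**: `Σ_x (A^{(2k)}(x))² = (r − 1) · 2^m · I` — operator norm `(r−1)·N`,
against the `λ·N`, `λ ≪ 1`, that a matrix Keller–Lifshitz inequality would have to deliver.
[cite: BuhrmanCleveWigderson1998, §3] [cite: ODonnell2014, Thm. 1.5] -/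
theorem sum_layer_sq (hc : ∀ i, (S i).card = k) (hd : ∀ i j, i ≠ j → Disjoint (S i) (S j)) (hk : 1 ≤ k) :
    ∑ x : Fin m → Bool, (layer (sfField S) (2 * k) x) ^ 2 =
      (((r : ℝ) - 1) * 2 ^ m) • (1 : Matrix (Fin r) (Fin r) ℝ) := by
  have e : ∀ x : Fin m → Bool, (layer (sfField S) (2 * k) x) ^ 2 = ((r : ℝ) - 2) • sfField S x + 1 := by
    intro x
    rw [layer_sfField hc hd hk, sq, sub_mul, mul_sub, mul_sub, sfField_mul_self, mul_one, one_mul, mul_one]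
    ext i j
    simp only [Matrix.sub_apply, Matrix.add_apply, Matrix.smul_apply, smul_eq_mul]
    ring
  simp_rw [e]
  rw [Finset.sum_add_distrib, ← Finset.smul_sum, sum_sfField hc hd hk, smul_smul, Finset.sum_const,
    Finset.card_univ, ← Nat.cast_smul_eq_nsmul ℝ, ← add_smul]
  congr 1
  simp
  ring

/-! ### §4 The technique class and the barrier -/

/-- TECHNIQUE CLASS: **an r-independent "globalness ⇒ layer-energy" inequality for whitened psd fields**
(the matrix / vector-valued Keller–Lifshitz input proposed for the r-uniform step, cell memo MEMO-19 §2(d)):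
a function `c : ℕ → ℝ` (allowed to depend on the layer index, NOT on the dimension `r`) such that for every
psd field `A : {0,1}^m → ℝ^{r×r}` with `Σ_x A(x) = 2^m·I` which is PERFECTLY directionally global below `2k`
(`Σ_x A(x|_{J←σ}) = 2^m·I` for all `|J| < 2k`, all `σ`), the layer-`2k` energy obeys
`Σ_x (A^{(2k)}(x))² ⪯ c(k)·2^m·I`. (Exact globalness, `τ = 1`, is the strongest hypothesis of the kind, so
the class contains every variant with a globalness parameter.) [cite: BenAroyaRegevDeWolf2008, Thm. 1 (what IS true: Schatten-normalised hypercontractivity)]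
[cite: ODonnell2014, §9.5 (scalar level-k inequalities, the case r = 1)] -/
def GlobalnessBoundsLayerEnergy (c : ℕ → ℝ) : Prop :=
  ∀ (m r k : ℕ), 1 ≤ k → ∀ A : (Fin m → Bool) → Matrix (Fin r) (Fin r) ℝ,
    (∀ x, (A x).PosSemidef) →
    (∑ x, A x = ((2 : ℝ) ^ m) • (1 : Matrix (Fin r) (Fin r) ℝ)) →
    (∀ (J : Finset (Fin m)) (σ : Fin m → Bool), J.card < 2 * k →
        ∑ x, A (J.piecewise σ x) = ((2 : ℝ) ^ m) • (1 : Matrix (Fin r) (Fin r) ℝ)) →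
    ((c k * 2 ^ m) • (1 : Matrix (Fin r) (Fin r) ℝ) - ∑ x, (layer A (2 * k) x) ^ 2).PosSemidef

/-- The standard block family on `m = r·k` coordinates: `S_i = {i} × [k]`. [folklore] -/
def blocks (r k : ℕ) : Fin r → Finset (Fin (r * k)) :=
  fun i => (Finset.univ : Finset (Fin k)).map ⟨fun j => finProdFinEquiv (i, j), fun j j' h => by
    have := finProdFinEquiv.injective h
    exact (Prod.mk.inj this).2⟩

/-- The standard blocks have `k` elements each. [folklore] -/
private theorem blocks_card (r k : ℕ) (i : Fin r) : (blocks r k i).card = k := by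
  rw [blocks, Finset.card_map, Finset.card_univ, Fintype.card_fin]

/-- The standard blocks are pairwise disjoint. [folklore] -/
private theorem blocks_disjoint (r k : ℕ) (i j : Fin r) (hij : i ≠ j) : Disjoint (blocks r k i) (blocks r k j) := by
  rw [Finset.disjoint_left]
  intro l hl hl'
  rw [blocks, Finset.mem_map] at hl hl'
  obtain ⟨a, -, ha⟩ := hl
  obtain ⟨b, -, hb⟩ := hl'
  have h := finProdFinEquiv.injective (ha.trans hb.symm)
  exact hij (Prod.mk.inj h).1

/-- A scalar matrix `a·I` (`r ≥ 1`) is psd only if `a ≥ 0`. [cite: HornJohnson2012, Thm. 4.2.2 (Rayleigh quotient)] -/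
private theorem nonneg_of_posSemidef_smul_one {a : ℝ} (hr : 1 ≤ r)
    (h : (a • (1 : Matrix (Fin r) (Fin r) ℝ)).PosSemidef) : 0 ≤ a := by
  have hq := (Matrix.posSemidef_iff_dotProduct_mulVec.1 h).2 (Pi.single ⟨0, hr⟩ 1)
  rwa [smul_mulVec, one_mulVec, dotProduct_smul, star_trivial, single_dotProduct, one_mul,
    Pi.single_eq_same, smul_eq_mul, mul_one] at hq

/-- **BARRIER (quantitative form).** Any admissible constant at layer `2k` is `≥ r − 1` for EVERY dimension
`r ≥ 1`: the sign-feature field of the standard blocks is psd, whitened, perfectly directionally global below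
`2k`, and has layer-`2k` energy exactly `(r − 1)·2^m·I`. [cite: BuhrmanCleveWigderson1998, §3]
[cite: FranklWilson1981, §3] -/
theorem constant_ge (c : ℕ → ℝ) (h : GlobalnessBoundsLayerEnergy c) {k : ℕ} (hk : 1 ≤ k) {r : ℕ}
    (hr : 1 ≤ r) : (r : ℝ) - 1 ≤ c k := by
  have hc := blocks_card r k
  have hd := blocks_disjoint r k
  have hpsd := h (r * k) r k hk (sfField (blocks r k)) (fun x => sfField_posSemidef _ x) (sum_sfField hc hd hk)
    (fun J σ hJ => sum_sfField_piecewise hc hd J σ hJ)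
  rw [sum_layer_sq hc hd hk, ← sub_smul, ← sub_mul] at hpsd
  have h0 := nonneg_of_posSemidef_smul_one hr hpsd
  have h2 : (0 : ℝ) < 2 ^ (r * k) := by positivity
  have := (mul_nonneg_iff_of_pos_right h2).1 h0
  linarith

/-- **BARRIER (qualitative form): there is no r-independent "globalness ⇒ layer energy" inequality for
whitened psd fields** — `¬ GlobalnessBoundsLayerEnergy c` for every `c`. So the r-uniform dense-cell step of
the crux `TracialDecayExp20` cannot be fed by a matrix / vector-valued Keller–Lifshitz inequality in
OPERATOR-norm layer energy (what IS dimension-free is the TRACE-normalised level law,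
`Literature.Computability.Complexity.MatrixHypercontractivity.contraction_traceNorm_level_le`).
[cite: BuhrmanCleveWigderson1998, §3] [cite: BenAroyaRegevDeWolf2008, Thm. 1] -/
theorem not_globalnessBoundsLayerEnergy (c : ℕ → ℝ) : ¬ GlobalnessBoundsLayerEnergy c := by
  intro h
  have h1 := constant_ge c h (k := 1) le_rfl (r := ⌈|c 1|⌉₊ + 3) (by omega)
  have h2 : |c 1| ≤ (⌈|c 1|⌉₊ : ℝ) := Nat.le_ceil _
  have h3 : c 1 ≤ |c 1| := le_abs_self _
  push_cast at h1
  linarith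

end Literature.Barriers.PneNP.GlobalFieldLayerEnergy
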